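import Literature.NumberTheory.Transcendental.KZCubicalCalculus
import Literature.NumberTheory.Transcendental.KZRelationsLE
import Literature.NumberTheory.Transcendental.KZSemiCanonicalReductionProofs
import Summits.KontsevichZagierPeriods.KontsevichZagierPeriods.Theorems.MzvKernelInKZ.Negative.ScalingDivision
import HarnessLib

/-!
# Crux `KernelForm` (stmt-KontsevichZagierPeriods-10447), line `Sketch`: the rational box
# `b • [0, a/b] × [0,1]^k ≡ a • [0,1]^{k+1}` modulo the moves (registered stub `stub_rationalBox`)

For `0 < a`, `0 < b`, a representation `R` with domain the rational box
`[0, a/b] × [0,1]^k ⊆ ℝ^{k+1}` and integrand `1`, and a representation `U` with domain the closed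
unit cube `KZ.cube (k+1)` and integrand `1`, we prove `b • [R] − a • [U] ∈ KZ.relations`.

Proof: ONE change of variables (Kontsevich–Zagier rule (2)) along the linear map
`x ↦ (b/a · x₀, x₁, …, x_k)` — a polynomial map over `ℚ`, injective, of constant Jacobian `b/a`,
carrying the box onto the cube — turns `[R]` into the scaled cube `[cube, a/b]`
(`KZ.IntegralRep.constMul`); then the scaling arithmetic of `ScalingDivision.lean`
(`[σ, n f] ≡ n • [σ, f]`, `of_constMul_nat_sub_nsmul_mem`) and congruence of integrands on the
domain (`of_sub_of_mem_relations_of_eqOn`) give `b • [cube, a/b] ≡ [cube, a] ≡ a • [cube, 1]`.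

References: M. Kontsevich, D. Zagier, *Periods* (2001), §1.2, rules (1b), (2).
-/

noncomputable section

open MeasureTheory Set MvPolynomial
open Literature.NumberTheory.Transcendental
open Literature.ModelTheory.ExponentialFields (IsSemialgebraic)
open Summit.KontsevichZagierPeriods.MzvKernelInKZ.Negative

namespace Summit.KontsevichZagierPeriods.KernelForm.LocaliseAtValuePrime

variable {n : ℕ}

/-! ### The coordinate rescaling `v ↦ (v with vᵢ ↦ q vᵢ)` -/

/-- The diagonal matrix `diag(1, …, q, …, 1)` (entry `q` at place `i`), as a continuous linear map,
acts by `v ↦ (v with vᵢ ↦ q vᵢ)`. [folklore] -/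
theorem coordScale_apply (i : Fin n) (q : ℝ) (v : Fin n → ℝ) :
    (LinearMap.toContinuousLinearMap
        (Matrix.toLin' (Matrix.diagonal fun j : Fin n => if j = i then q else 1))) v =
      Function.update v i (q * v i) := by
  ext j
  simp only [LinearMap.coe_toContinuousLinearMap', Matrix.toLin'_apply, Matrix.mulVec_diagonal]
  by_cases hj : j = i
  · subst hj; simp
  · simp [hj]

/-- The Jacobian determinant of the rescaling `v ↦ (v with vᵢ ↦ q vᵢ)` is `q`. [folklore] -/
theorem det_coordScale (i : Fin n) (q : ℝ) :
    (LinearMap.toContinuousLinearMap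
        (Matrix.toLin' (Matrix.diagonal fun j : Fin n => if j = i then q else 1))).det = q := by
  simp [LinearMap.det_toLin', Matrix.det_diagonal, Finset.prod_ite_eq']

/-- The rescaling `v ↦ (v with vᵢ ↦ q vᵢ)` is injective for `q ≠ 0`. [folklore] -/
theorem coordScale_injective (i : Fin n) {q : ℝ} (hq : q ≠ 0) :
    Function.Injective (fun v : Fin n → ℝ => Function.update v i (q * v i)) := by
  intro x y h
  ext j
  have hj := congr_fun h j
  by_cases hji : j = i
  · subst hji
    simp only [Function.update_self] at hj
    exact mul_left_cancel₀ hq hj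
  · simpa [Function.update_of_ne hji] using hj

/-- The rescaling `v ↦ (v with vᵢ ↦ q vᵢ)` by a rational `q` is a polynomial map over `ℚ`, hence
`ℚ`-semialgebraic on every `ℚ`-semialgebraic set. [folklore] -/
theorem isSemialgebraicMapOn_coordScale (i : Fin n) (q : ℚ) {s : Set (Fin n → ℝ)}
    (hs : IsSemialgebraic ℚ s) :
    IsSemialgebraicMapOn ℚ s (fun v : Fin n → ℝ => Function.update v i ((q : ℝ) * v i)) := by
  refine (isSemialgebraicMapOn_aeval (R := ℝ) hs fun j : Fin n =>
    if j = i then C q * X i else (X j : MvPolynomial (Fin n) ℚ)).congr fun x _ => ?_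
  ext j
  by_cases hji : j = i
  · subst hji
    simp
  · simp [hji]

/-- The rescaling `x₀ ↦ (b/a) x₀` carries the rational box `[0, a/b] × [0,1]^k` onto the closed unit
cube. [folklore] -/
theorem image_coordScale_rationalBox (k : ℕ) {a b : ℝ} (ha : 0 < a) (hb : 0 < b) :
    (fun v : Fin (k + 1) → ℝ => Function.update v 0 (b / a * v 0)) ''
        {x | (0 ≤ x 0 ∧ x 0 ≤ a / b) ∧ ∀ i, i ≠ 0 → 0 ≤ x i ∧ x i ≤ 1} = KZ.cube (k + 1) := by
  have ha' : a ≠ 0 := ha.ne'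
  have hb' : b ≠ 0 := hb.ne'
  ext y
  simp only [mem_image, mem_setOf_eq, KZ.mem_cube]
  constructor
  · rintro ⟨x, ⟨⟨hx0, hx0'⟩, hxi⟩, rfl⟩ i
    by_cases hi : i = 0
    · subst hi
      rw [Function.update_self]
      refine ⟨mul_nonneg (div_pos hb ha).le hx0, ?_⟩
      rw [div_mul_eq_mul_div, div_le_one ha]
      calc b * x 0 ≤ b * (a / b) := mul_le_mul_of_nonneg_left hx0' hb.le
        _ = a := mul_div_cancel₀ a hb'
    · rw [Function.update_of_ne hi]
      exact hxi i hi
  · intro hy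
    refine ⟨Function.update y 0 (a / b * y 0), ⟨?_, fun i hi => ?_⟩, ?_⟩
    · rw [Function.update_self]
      exact ⟨mul_nonneg (div_pos ha hb).le (hy 0).1,
        mul_le_of_le_one_right (div_pos ha hb).le (hy 0).2⟩
    · rw [Function.update_of_ne hi]
      exact hy i
    · ext j
      by_cases hj : j = 0
      · subst hj
        rw [Function.update_self, Function.update_self]
        field_simp
      · rw [Function.update_of_ne hj, Function.update_of_ne hj]

/-! ### The change of variables and the scaling arithmetic -/

/-- **The change of variables.** Along `x ↦ (b/a · x₀, x₁, …, x_k)` (constant Jacobian `b/a`), the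
rational box `[0, a/b] × [0,1]^k` with integrand `1` differs by ONE move (2) of the
Kontsevich–Zagier calculus from the closed unit cube with integrand `a/b`. [folklore] -/
theorem of_rationalBox_sub_of_constMul_mem {k a b : ℕ} (R U : KZ.IntegralRep (k + 1))
    (ha : 0 < a) (hb : 0 < b)
    (hRd : R.domain = {x | (0 ≤ x 0 ∧ x 0 ≤ (a : ℝ) / b) ∧ ∀ i, i ≠ 0 → 0 ≤ x i ∧ x i ≤ 1})
    (hRi : R.integrand = fun _ => 1) (hUd : U.domain = KZ.cube (k + 1))
    (hUi : U.integrand = fun _ => 1) (halg : IsAlgebraic ℚ ((a : ℝ) / b)) :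
    KZ.of R - KZ.of (U.constMul ((a : ℝ) / b) halg) ∈ KZ.relations := by
  have ha' : (0 : ℝ) < a := by exact_mod_cast ha
  have hb' : (0 : ℝ) < b := by exact_mod_cast hb
  obtain ⟨L, hL⟩ : ∃ L : (Fin (k + 1) → ℝ) →L[ℝ] (Fin (k + 1) → ℝ),
      L = LinearMap.toContinuousLinearMap (Matrix.toLin'
        (Matrix.diagonal fun j : Fin (k + 1) => if j = 0 then (b : ℝ) / a else 1)) := ⟨_, rfl⟩
  have hLfun : (⇑L) = fun v => Function.update v 0 ((b : ℝ) / a * v 0) := by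
    rw [hL]
    exact funext (coordScale_apply 0 _)
  have hLdet : L.det = (b : ℝ) / a := by
    rw [hL]
    exact det_coordScale 0 _
  refine KZ.changeOfVariablesRel_subset_relations
    ⟨k + 1, R, U.constMul ((a : ℝ) / b) halg, ⇑L, fun _ => L, ?_, ?_, ?_, ?_, ?_, rfl⟩
  · have e : ((b : ℝ) / a) = (((b : ℚ) / a : ℚ) : ℝ) := by push_cast; rfl
    rw [hLfun, e]
    exact isSemialgebraicMapOn_coordScale 0 _ R.isSemialgebraic_domain
  · exact fun x _ => L.hasFDerivWithinAt
  · rw [hLfun]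
    exact (coordScale_injective 0 (div_pos hb' ha').ne').injOn
  · rw [KZ.IntegralRep.domain_constMul, hUd, hRd, hLfun]
    exact (image_coordScale_rationalBox k ha' hb').symm
  · intro x _
    simp only [hRi, KZ.IntegralRep.integrand_constMul, hUi, mul_one]
    rw [hLdet, abs_of_pos (div_pos hb' ha')]
    field_simp

/-- **Scaling arithmetic**: if `b ρ = a` then `b • [σ, ρ f] ≡ a • [σ, f]` modulo the moves
(`b • [σ, ρ f] ≡ [σ, b ρ f] = [σ, a f] ≡ a • [σ, f]`). [folklore] -/
theorem nsmul_of_constMul_sub_nsmul_of_mem {m : ℕ} (U : KZ.IntegralRep m) {ρ : ℝ}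
    (hρ : IsAlgebraic ℚ ρ) {a b : ℕ} (h : (b : ℝ) * ρ = a) :
    b • KZ.of (U.constMul ρ hρ) - a • KZ.of U ∈ KZ.relations := by
  have h1 : KZ.of ((U.constMul ρ hρ).constMul (b : ℝ) (isAlgebraic_natCast b)) -
      b • KZ.of (U.constMul ρ hρ) ∈ KZ.relations :=
    of_constMul_nat_sub_nsmul_mem b _
  have h2 : KZ.of (U.constMul (a : ℝ) (isAlgebraic_natCast a)) - a • KZ.of U ∈ KZ.relations :=
    of_constMul_nat_sub_nsmul_mem a U
  have h3 : KZ.of ((U.constMul ρ hρ).constMul (b : ℝ) (isAlgebraic_natCast b)) -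
      KZ.of (U.constMul (a : ℝ) (isAlgebraic_natCast a)) ∈ KZ.relations :=
    of_sub_of_mem_relations_of_eqOn rfl fun x _ => by
      simp only [KZ.IntegralRep.integrand_constMul]
      rw [← mul_assoc, h]
  have e : b • KZ.of (U.constMul ρ hρ) - a • KZ.of U =
      (KZ.of ((U.constMul ρ hρ).constMul (b : ℝ) (isAlgebraic_natCast b)) -
          KZ.of (U.constMul (a : ℝ) (isAlgebraic_natCast a))) +
        (KZ.of (U.constMul (a : ℝ) (isAlgebraic_natCast a)) - a • KZ.of U) -
        (KZ.of ((U.constMul ρ hρ).constMul (b : ℝ) (isAlgebraic_natCast b)) -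
          b • KZ.of (U.constMul ρ hρ)) := by
    abel
  rw [e]
  exact KZ.relations.sub_mem (KZ.relations.add_mem h3 h2) h1

/-- **The rational box** (registered stub `stub_rationalBox` of crux `KernelForm`, line `Sketch`):
the box `[0, a/b] × [0,1]^k` with integrand `1`, taken `b` times, equals the closed unit cube
`[0,1]^{k+1}` with integrand `1`, taken `a` times, modulo the moves of the Kontsevich–Zagier
calculus. [folklore] -/
theorem stub_rationalBox :
    ∀ (k a b : ℕ) (R U : KZ.IntegralRep (k + 1)), 0 < a → 0 < b →
      R.domain = {x | (0 ≤ x 0 ∧ x 0 ≤ (a : ℝ) / b) ∧ ∀ i, i ≠ 0 → 0 ≤ x i ∧ x i ≤ 1} →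
      (R.integrand = fun _ => 1) → U.domain = KZ.cube (k + 1) → (U.integrand = fun _ => 1) →
      b • KZ.of R - a • KZ.of U ∈ KZ.relations := by
  intro k a b R U ha hb hRd hRi hUd hUi
  have hb' : (b : ℝ) ≠ 0 := by exact_mod_cast hb.ne'
  have halg : IsAlgebraic ℚ ((a : ℝ) / b) := by
    rw [div_eq_mul_inv]
    exact (isAlgebraic_natCast a).mul (isAlgebraic_natCast b).inv
  have h1 : KZ.of R - KZ.of (U.constMul ((a : ℝ) / b) halg) ∈ KZ.relations :=
    of_rationalBox_sub_of_constMul_mem R U ha hb hRd hRi hUd hUi halg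
  have h2 : b • KZ.of (U.constMul ((a : ℝ) / b) halg) - a • KZ.of U ∈ KZ.relations :=
    nsmul_of_constMul_sub_nsmul_of_mem U halg (mul_div_cancel₀ (a : ℝ) hb')
  have e : b • KZ.of R - a • KZ.of U =
      b • (KZ.of R - KZ.of (U.constMul ((a : ℝ) / b) halg)) +
        (b • KZ.of (U.constMul ((a : ℝ) / b) halg) - a • KZ.of U) := by
    rw [nsmul_sub]
    abel
  rw [e]
  exact KZ.relations.add_mem (KZ.relations.nsmul_mem h1 b) h2

end Summit.KontsevichZagierPeriods.KernelForm.LocaliseAtValuePrime
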